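import Summits.AtomisticToContinuum.Crystallization.Theorems.ExcessDecayLiouvillePhononStabilityPullbackBonds

/-!
# `PhononStability` (stmt-AtomisticToContinuum-9333), line `contragredient-window-collapse`: stub `stub_pullback`

Reduction S1b of the line (the ANALYTIC half of the pull-back, `PullbackReduction`).  Given a window cell `A`
(`CellWindow A`), a pulled-back shift error `δ` (`ShiftWindow A δ`), a contragredient `B` (`⟪Ax, By⟫ = ⟪x, y⟫`,
i.e. `B = A⁻ᵀ`) and the label bijection `ℓ ↦ t 0 + A·refPos δ ℓ : Fin 2 × ℤ³ ≃ Sites₀ t A`, every finitely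
supported displacement `u` of the site set is pulled back to the finitely supported label field
`w = Aᵀ ∘ u ∘ site` (so that `u ∘ site = B ∘ w`, because `B Aᵀ = id` by contragredience and surjectivity of `A`),
and — granted the lattice sum `Σ_c ‖ζ⁰_c‖⁻⁸ Σ_k ‖Δ_c w k‖² < ∞` — the two typed double `tsum`s of the crux are
re-indexed into the class-indexed forms of the line:

* pair geometry: for labels `ℓ = (m, k)`, `ℓ' = (m', k')` and the class `c = (m, m', k' − k)`,
  `site ℓ − site ℓ' = −A ζ_c(δ)` and `u(site ℓ) − u(site ℓ') = −B Δ_c w k`, so that (by evenness of `Hess₀` and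
  the per-bond pull-back identity `Hess₀ (Aζ) (BΔ) = ω(‖Aζ‖)⟪ζ, Δ⟫² + ψ(‖Aζ‖)‖BΔ‖²` of the per-bond file
  `ExcessDecayLiouvillePhononStabilityPullbackBonds.lean`) both crux summands are class summands evaluated at
  `((m, m', k' − k), k)`;
* absolute summability over `BondClass × ℤ³`: both class summands are bounded by `C‖ζ⁰_c‖⁻⁸‖Δ_c w k‖²`
  (per-bond file), a nonnegative majorant which is finitely supported in `k` for each class and whose class sums
  `C‖ζ⁰_c‖⁻⁸·plainForm c w` are summable by the lattice-sum hypothesis (`summable_prod_of_nonneg`);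
* the re-indexing `Sites × Sites ≃ Label × Label ≃ BondClass × ℤ³`, `((m,k),(m',k')) ↦ ((m,m',k'−k), k)`, through
  `Equiv.tsum_eq` and `Summable.tsum_prod`; the class sums are `classTerm` (`HasSum.prod_fiberwise` gives
  `Summable (classTerm A B δ w)` and `Hform`), respectively the cut-off metric functional of `Nform`.

All `[folklore]`.
-/

noncomputable section

open scoped BigOperators Classical InnerProductSpace
open Filter Set Function
open Literature.MathematicalPhysics.StatisticalMechanics
open Summit.AtomisticToContinuum.Crystallization.Theses.ExcessDecayLiouville
open Summit.AtomisticToContinuum.Crystallization.Theorems.PhononStabilityNegative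
open Summit.AtomisticToContinuum.Crystallization.Theorems.PhononStabilityCWC

namespace Summit.AtomisticToContinuum.Crystallization.Theorems.PhononStabilityCWC.PullbackStub

/-! ## Copies of the line's elementary API (its Basics file is not yet in the tree) -/

/-- `latVec` is additive; copy of the line's Basics lemma. [folklore] -/
private theorem latVec_add (n n' : Fin 3 → ℤ) : latVec (n + n') = latVec n + latVec n' := by
  simp only [latVec, Pi.add_apply, Int.cast_add, add_smul]
  abel

/-- `latVec 0 = 0`; copy of the line's Basics lemma. [folklore] -/
private theorem latVec_zero : latVec 0 = 0 := by simp [latVec]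

/-- `site(m', k + n) − site(m, k) = A ζ_{(m,m',n)}(δ)` (the line's Basics lemma `siteMap_sub`). [folklore] -/
private theorem siteMap_sub (t : Fin 2 → EuclideanSpace ℝ (Fin 3))
    (A : EuclideanSpace ℝ (Fin 3) →L[ℝ] EuclideanSpace ℝ (Fin 3)) (δ : EuclideanSpace ℝ (Fin 3))
    (m m' : Fin 2) (k n : Fin 3 → ℤ) :
    siteMap t A δ (m', k + n) - siteMap t A δ (m, k) = A (bondVec δ (m, m', n)) := by
  simp only [siteMap, bondVec, refPos, latVec_add, latVec_zero, zero_add, add_sub_add_left_eq_sub, ← map_sub]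
  congr 1
  abel

/-! ## Summability over `BondClass × ℤ³` and the re-indexing -/

section Sums

variable {w : Label → EuclideanSpace ℝ (Fin 3)}

/-- For a finitely supported label field each class family `k ↦ Δ_c w k` is finitely supported. [folklore] -/
theorem finite_support_bondDiff (hw : (support w).Finite) (c : BondClass) :
    (support fun k => bondDiff c w k).Finite := by
  obtain ⟨m, m', n⟩ := c
  have h1 : (support fun k : Fin 3 → ℤ => w (m', k + n)).Finite := by
    change (support (w ∘ fun k : Fin 3 → ℤ => ((m', k + n) : Label))).Finite
    rw [support_comp_eq_preimage]
    exact hw.preimage fun k _ k' _ h => by simpa using h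
  have h2 : (support fun k : Fin 3 → ℤ => w (m, k)).Finite := by
    change (support (w ∘ fun k : Fin 3 → ℤ => ((m, k) : Label))).Finite
    rw [support_comp_eq_preimage]
    exact hw.preimage fun k _ k' _ h => by simpa using h
  show (support fun k : Fin 3 → ℤ => w (m', k + n) - w (m, k)).Finite
  exact (h1.union h2).subset (support_sub _ _)

/-- **Dominated summability over `BondClass × ℤ³`:** a family bounded by `C·‖ζ⁰_c‖⁻⁸·‖Δ_c w k‖²` is summable,
granted the lattice sum `Σ_c ‖ζ⁰_c‖⁻⁸·Σ_k ‖Δ_c w k‖² < ∞` (the majorant is nonnegative, finitely supported in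
`k` for each class, with class sums `C·‖ζ⁰_c‖⁻⁸·plainForm c w`). [folklore] -/
theorem summable_uncurry_of_le (hw : (support w).Finite) (hls : LatticeSummable w) {C : ℝ} (hC : 0 ≤ C)
    {G : BondClass → (Fin 3 → ℤ) → ℝ}
    (hG : ∀ c k, |G c k| ≤ C * (‖bondVec 0 c‖⁻¹) ^ 8 * ‖bondDiff c w k‖ ^ 2) :
    Summable (Function.uncurry G) := by
  set g : BondClass × (Fin 3 → ℤ) → ℝ := fun p =>
    C * (‖bondVec 0 p.1‖⁻¹) ^ 8 * ‖bondDiff p.1 w p.2‖ ^ 2 with hg_def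
  have hg0 : 0 ≤ g := fun p => by positivity
  have hgs : Summable g := by
    refine (summable_prod_of_nonneg hg0).2 ⟨fun c => ?_, ?_⟩
    · refine summable_of_hasFiniteSupport ((finite_support_bondDiff hw c).subset fun k hk => ?_)
      rw [mem_support] at hk ⊢
      contrapose! hk
      simp [hg_def, hk]
    · have : (fun c => ∑' k, g (c, k)) = fun c => C * ((‖bondVec 0 c‖⁻¹) ^ 8 * plainForm c w) := by
        funext c
        simp only [hg_def, plainForm]
        rw [← tsum_mul_left, ← tsum_mul_left]
        exact tsum_congr fun k => by ring
      rw [this]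
      exact hls.mul_left C
  refine Summable.of_norm_bounded hgs fun p => ?_
  rw [Real.norm_eq_abs]
  exact hG p.1 p.2

/-- **Re-indexing pairs of labels by (class, base point):** along the bijection
`((m, k), (m', k')) ↦ ((m, m', k' − k), k)` an absolutely summable class family re-sums the double label `tsum`
(`Equiv.tsum_eq`, `Summable.tsum_prod`). [folklore] -/
theorem tsum_tsum_reindex (G : BondClass → (Fin 3 → ℤ) → ℝ) (hG : Summable (Function.uncurry G)) :
    ∑' ℓ : Label, ∑' ℓ' : Label, G (ℓ.1, ℓ'.1, ℓ'.2 - ℓ.2) ℓ.2 =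
      ∑' c : BondClass, ∑' k : Fin 3 → ℤ, G c k := by
  let e : Label × Label ≃ BondClass × (Fin 3 → ℤ) :=
    { toFun := fun p => ((p.1.1, p.2.1, p.2.2 - p.1.2), p.1.2)
      invFun := fun q => ((q.1.1, q.2), (q.1.2.1, q.2 + q.1.2.2))
      left_inv := fun p => by
        obtain ⟨⟨m, k⟩, ⟨m', k'⟩⟩ := p
        simp
      right_inv := fun q => by
        obtain ⟨⟨m, m', n⟩, k⟩ := q
        simp }
  have h1 : Summable (Function.uncurry G ∘ e) := e.summable_iff.mpr hG
  calc ∑' ℓ : Label, ∑' ℓ' : Label, G (ℓ.1, ℓ'.1, ℓ'.2 - ℓ.2) ℓ.2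
      = ∑' p : Label × Label, (Function.uncurry G ∘ e) p := h1.tsum_prod.symm
    _ = ∑' q : BondClass × (Fin 3 → ℤ), Function.uncurry G q := e.tsum_eq (Function.uncurry G)
    _ = ∑' c : BondClass, ∑' k : Fin 3 → ℤ, G c k := hG.tsum_prod

end Sums

/-! ## The stub -/

/-- **S1b — PULL-BACK REDUCTION** (`stub_pullback`): with `w = Aᵀ ∘ u ∘ site` (finitely supported,
`u ∘ site = B ∘ w`), and granted the lattice sum for `w`, the class family is summable and
`nnForm t A u = Nform A B δ w`, `hessForm t A u = Hform A B δ w` (label bijection, pair geometry, per-bond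
pull-back identity, absolute summability, re-indexing by classes). [folklore] -/
theorem stub_pullback : PullbackReduction := by
  intro t A B δ hW hδ hAB hinj hrange u hu hsupp
  -- `B ∘ Aᵀ = id` (contragredience tested against all `A x`; `A` is onto, `A A⁻¹ = id`)
  obtain ⟨Ai, -, hAi⟩ := LabelsStub.exists_inverse_of_cellWindow hW
  have hBA : ∀ y, B (ContinuousLinearMap.adjoint A y) = y := fun y => by
    refine ext_inner_left ℝ fun z => ?_
    rw [← hAi z, hAB (Ai z), ContinuousLinearMap.adjoint_inner_right]
  -- the pulled-back label field
  set w : Label → EuclideanSpace ℝ (Fin 3) := fun ℓ => ContinuousLinearMap.adjoint A (u (siteMap t A δ ℓ))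
    with hw_def
  have huw : ∀ ℓ, u (siteMap t A δ ℓ) = B (w ℓ) := fun ℓ => (hBA _).symm
  have hw : (support w).Finite := by
    refine (hu.preimage hinj.injOn).subset fun ℓ hℓ => ?_
    rw [mem_preimage, mem_support]
    intro h0
    exact hℓ (by simp [hw_def, h0])
  refine ⟨w, hw, fun hls => ?_⟩
  -- the label bijection and the re-indexing of double site sums by labels
  have hmem : ∀ ℓ, siteMap t A δ ℓ ∈ Sites₀ t A := fun ℓ => by
    rw [← hrange]
    exact mem_range_self ℓ
  have hsurj : Function.Surjective fun ℓ => (⟨siteMap t A δ ℓ, hmem ℓ⟩ : Sites₀ t A) := fun p => by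
    have hp : (p : EuclideanSpace ℝ (Fin 3)) ∈ range (siteMap t A δ) := by
      rw [hrange]
      exact p.2
    obtain ⟨ℓ, hℓ⟩ := hp
    exact ⟨ℓ, Subtype.ext hℓ⟩
  let eS : Label ≃ Sites₀ t A := Equiv.ofBijective (fun ℓ => ⟨siteMap t A δ ℓ, hmem ℓ⟩)
    ⟨fun a b h => hinj (congrArg Subtype.val h), hsurj⟩
  have reidx : ∀ F : EuclideanSpace ℝ (Fin 3) → EuclideanSpace ℝ (Fin 3) → ℝ,
      ∑' p : Sites₀ t A, ∑' q : Sites₀ t A, F p q =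
        ∑' ℓ : Label, ∑' ℓ' : Label, F (siteMap t A δ ℓ) (siteMap t A δ ℓ') := fun F =>
    calc ∑' p : Sites₀ t A, ∑' q : Sites₀ t A, F p q
        = ∑' ℓ : Label, ∑' q : Sites₀ t A, F (eS ℓ) q :=
          (eS.tsum_eq (fun p : Sites₀ t A => ∑' q : Sites₀ t A, F p q)).symm
      _ = ∑' ℓ : Label, ∑' ℓ' : Label, F (eS ℓ) (eS ℓ') :=
          tsum_congr fun ℓ => (eS.tsum_eq (fun q : Sites₀ t A => F (eS ℓ) q)).symm
      _ = ∑' ℓ : Label, ∑' ℓ' : Label, F (siteMap t A δ ℓ) (siteMap t A δ ℓ') := rfl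
  -- pair geometry
  have hgeo : ∀ ℓ ℓ' : Label, siteMap t A δ ℓ - siteMap t A δ ℓ' =
      -A (bondVec δ (ℓ.1, ℓ'.1, ℓ'.2 - ℓ.2)) := by
    rintro ⟨m, k⟩ ⟨m', k'⟩
    dsimp only
    have h := siteMap_sub t A δ m m' k (k' - k)
    rw [add_sub_cancel] at h
    rw [← h, neg_sub]
  have hdiff : ∀ ℓ ℓ' : Label, u (siteMap t A δ ℓ) - u (siteMap t A δ ℓ') =
      -B (bondDiff (ℓ.1, ℓ'.1, ℓ'.2 - ℓ.2) w ℓ.2) := by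
    rintro ⟨m, k⟩ ⟨m', k'⟩
    dsimp only
    rw [huw, huw]
    simp only [bondDiff, add_sub_cancel, map_sub, neg_sub]
  -- the pulled-back summands and their absolute summability
  set T : BondClass → (Fin 3 → ℤ) → ℝ := fun c k =>
    omegaLJ ‖A (bondVec δ c)‖ * (inner ℝ (bondVec δ c) (bondDiff c w k)) ^ 2 +
      psiLJ ‖A (bondVec δ c)‖ * ‖B (bondDiff c w k)‖ ^ 2 with hT_def
  have hT : Summable (Function.uncurry T) :=
    summable_uncurry_of_le hw hls (by norm_num) fun c k => abs_classSummand_le hW hδ hAB w c k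
  set TN : BondClass → (Fin 3 → ℤ) → ℝ := fun c k =>
    if ‖A (bondVec δ c)‖ ≤ 11 / 10 then ‖B (bondDiff c w k)‖ ^ 2 else 0 with hTN_def
  have hTN : Summable (Function.uncurry TN) :=
    summable_uncurry_of_le hw hls (by norm_num) fun c k => abs_nnSummand_le hW hδ hAB w c k
  -- class sums of the second-variation summand
  have hTc : ∀ c, HasSum (fun k => T c k) (classTerm A B δ w c) := fun c => by
    have h1 : Summable fun k => (inner ℝ (bondVec δ c) (bondDiff c w k)) ^ 2 :=
      summable_of_hasFiniteSupport ((finite_support_bondDiff hw c).subset fun k hk => by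
        rw [mem_support] at hk ⊢
        contrapose! hk
        simp [hk])
    have h2 : Summable fun k => ‖B (bondDiff c w k)‖ ^ 2 :=
      summable_of_hasFiniteSupport ((finite_support_bondDiff hw c).subset fun k hk => by
        rw [mem_support] at hk ⊢
        contrapose! hk
        simp [hk])
    exact (h1.hasSum.mul_left _).add (h2.hasSum.mul_left _)
  have hH : HasSum (classTerm A B δ w) (∑' p, Function.uncurry T p) := hT.hasSum.prod_fiberwise hTc
  refine ⟨hH.summable, ?_, ?_⟩
  · -- `nnForm = Nform`
    have e1 : nnForm t A u = ∑' ℓ : Label, ∑' ℓ' : Label,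
        (if dist (siteMap t A δ ℓ) (siteMap t A δ ℓ') ≤ 11 / 10 then
          ‖u (siteMap t A δ ℓ) - u (siteMap t A δ ℓ')‖ ^ 2 else 0) :=
      reidx fun p q => if dist p q ≤ 11 / 10 then ‖u p - u q‖ ^ 2 else 0
    calc nnForm t A u = ∑' ℓ : Label, ∑' ℓ' : Label, TN (ℓ.1, ℓ'.1, ℓ'.2 - ℓ.2) ℓ.2 := by
          rw [e1]
          refine tsum_congr fun ℓ => tsum_congr fun ℓ' => ?_
          rw [hTN_def, dist_eq_norm, hgeo, hdiff, norm_neg, norm_neg]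
      _ = ∑' c : BondClass, ∑' k, TN c k := tsum_tsum_reindex TN hTN
      _ = Nform A B δ w := by
          unfold Nform
          refine tsum_congr fun c => ?_
          rw [hTN_def]
          dsimp only
          split_ifs with h
          · rfl
          · exact tsum_zero
  · -- `hessForm = Hform`
    have e2 : hessForm t A u = ∑' ℓ : Label, ∑' ℓ' : Label,
        (if siteMap t A δ ℓ ≠ siteMap t A δ ℓ' then
          Hess₀ (siteMap t A δ ℓ - siteMap t A δ ℓ') (u (siteMap t A δ ℓ) - u (siteMap t A δ ℓ')) else 0) :=
      reidx fun p q => if p ≠ q then Hess₀ (p - q) (u p - u q) else 0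
    calc hessForm t A u = ∑' ℓ : Label, ∑' ℓ' : Label, T (ℓ.1, ℓ'.1, ℓ'.2 - ℓ.2) ℓ.2 := by
          rw [e2]
          refine tsum_congr fun ℓ => tsum_congr fun ℓ' => ?_
          by_cases h : ℓ = ℓ'
          · subst h
            rw [if_neg (not_not.mpr rfl), hT_def]
            simp [bondVec, omegaLJ, psiLJ]
          · have hne : siteMap t A δ ℓ ≠ siteMap t A δ ℓ' := fun e => h (hinj e)
            have hAζ : A (bondVec δ (ℓ.1, ℓ'.1, ℓ'.2 - ℓ.2)) ≠ 0 := fun h0 => hne (by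
              rw [← sub_eq_zero, hgeo, h0, neg_zero])
            rw [if_pos hne, hgeo, hdiff, Hess₀_neg_left, Hess₀_neg_right, hT_def]
            exact Hess₀_pullback hAB _ _ hAζ
      _ = ∑' c : BondClass, ∑' k, T c k := tsum_tsum_reindex T hT
      _ = Hform A B δ w := by
          unfold Hform
          exact tsum_congr fun c => (hTc c).tsum_eq

end Summit.AtomisticToContinuum.Crystallization.Theorems.PhononStabilityCWC.PullbackStub

end
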